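import Mathlib
import Mathlib.Analysis.Calculus.BumpFunction.FiniteDimension
import Summits.RiemannHypothesis.RiemannHypothesis.Theorems.RuelleBandCofiniteCriticalLineStubZeroLevelNullVectorAux2
import Literature.NumberTheory.LFunctions.WeilSemilocalCompactnessProofs
import Literature.NumberTheory.LFunctions.WeilWindowSimpleEven
import Literature.NumberTheory.LFunctions.WeilExplicitProofs
import HarnessLib

/-!
# Stub `stub_zeroLevelNullVector`, helper file 3/5: the upper Courant–Fischer bound, extraction of witnesses; independent window tests
(item stmt-RiemannHypothesis-2064, route route-RiemannHypothesis-RuelleBand; registered stub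
`stub_zeroLevelNullVector` of line `cofinite-weil-index-staircase` — "a zero min–max level of the
window form is a null vector", the attainment half of the crossing lemma).

Abstract Hilbert-space layer, continued.

* `stub_zeroLevelNullVector_claimA`: the `≤` half of Courant–Fischer at level `N` over the core —
  if `N + 1` eigen-levels are negative, the span of the eigenvectors is form-negative-definite, and
  approximating them from the dense core (`UniformSpace.Completion.denseRange_coe`) gives a linearly
  independent core tuple whose inner level set lies strictly below `0`.
* `stub_zeroLevelNullVector_extract`: a null vector `e` of the closed form in the completion
  (`⟪z, e⟫ = C⟪T̂ z, T̂ e⟫` for all `z`, `T̂ e ≠ 0`) yields the witnesses seen from the core: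
  `T xₙ → T̂ e ≠ 0`, form-Cauchy differences on `ℕ × ℕ`, and `⟪h, xₙ⟫ - C⟪T h, T xₙ⟫ → 0`.

Weil layer (registered sub-goal `stub_zeroLevelNullVector_exists_linearIndependent`): for `a > 0`
and every `N` there are `N + 1` linearly independent test functions on the window `[-a, a]`
(disjoint smooth bumps), i.e. the core is infinite-dimensional and the outer level set is nonempty.

No definitions, no named facts. Reference: M. Reed, B. Simon, *Methods of Modern Mathematical
Physics IV*, Thm. XIII.2 (the form core may replace the form domain in min–max).
-/

set_option linter.dupNamespace false -- justified: the module path repeats `RiemannHypothesis` (summit = problem); header prescribed by the line lead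

noncomputable section

open Complex MeasureTheory Filter Set
open scoped BigOperators Topology ComplexConjugate InnerProductSpace

namespace Summit.RiemannHypothesis.RiemannHypothesis.Theorems.RuelleBandCofiniteCriticalLine

open Literature.NumberTheory.LFunctions

section AbstractLayer

variable {W : Type*} [NormedAddCommGroup W] [InnerProductSpace ℂ W]
variable {H : Type*} [NormedAddCommGroup H] [InnerProductSpace ℂ H] [CompleteSpace H]

section ClaimUpper

omit [CompleteSpace H] in
/-- **Upper bound (Courant–Fischer, `≤` half).** If `N + 1` indices have `1 - C κᵢ < 0`, the span
of the corresponding eigenvectors is a form-negative-definite `(N+1)`-dimensional subspace of the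
completion; approximating its basis from the dense core gives a linearly independent core tuple
whose inner level set lies strictly below `0`. (Reed–Simon IV, Thm. XIII.2: the form core may
replace the form domain in min–max.) [folklore] -/
theorem stub_zeroLevelNullVector_claimA (T : W →L[ℂ] H) (C : ℝ) {N : ℕ}
    (hTinj : Function.Injective T)
    (Th : UniformSpace.Completion W →L[ℂ] H) (hTh : ∀ x : W, Th x = T x)
    {s : Set (UniformSpace.Completion W)} (b : HilbertBasis s ℂ (UniformSpace.Completion W))
    (κ : s → ℝ) (hk4 : ∀ i z, ⟪Th (b i), Th z⟫_ℂ = (κ i : ℂ) * ⟪b i, z⟫_ℂ)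
    (I : Finset s) (hI : I.card = N + 1) (hneg : ∀ i ∈ I, 1 - C * κ i < 0) :
    ∃ y : Fin (N + 1) → W, LinearIndependent ℂ y ∧
      sSup {r : ℝ | ∃ c : Fin (N + 1) → ℂ, ‖T (∑ i, c i • y i)‖ ^ 2 = 1 ∧
        r = ‖∑ i, c i • y i‖ ^ 2 - C * ‖T (∑ i, c i • y i)‖ ^ 2} < 0 := by
  classical
  -- the gap `δ`
  have hIne : I.Nonempty := by rw [← Finset.card_pos, hI]; exact Nat.succ_pos N
  obtain ⟨i₀, hi₀I, hi₀⟩ := Finset.exists_min_image I (fun i => C * κ i - 1) hIne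
  set δ : ℝ := C * κ i₀ - 1 with hδ
  have hδpos : 0 < δ := by have := hneg i₀ hi₀I; rw [hδ]; linarith
  have hδle : ∀ i ∈ I, δ ≤ C * κ i - 1 := fun i hi => hi₀ i hi
  -- the orthonormal eigenvectors indexed by `Fin (N+1)`
  set e : I ≃ Fin (N + 1) := Finset.equivFinOfCardEq hI with he
  set idx : Fin (N + 1) → s := fun j => ((e.symm j : I) : s) with hidx
  have hidxI : ∀ j, idx j ∈ I := fun j => (e.symm j).2
  have hidx_inj : Function.Injective idx := fun j j' h =>
    e.symm.injective (Subtype.ext h)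
  set u : Fin (N + 1) → UniformSpace.Completion W := fun j => b (idx j) with hu
  have huon : Orthonormal ℂ u := b.orthonormal.comp idx hidx_inj
  have hk4' : ∀ j w, ⟪Th (u j), Th w⟫_ℂ = ((κ (idx j) : ℝ) : ℂ) * ⟪u j, w⟫_ℂ := fun j w =>
    hk4 (idx j) w
  have hqz : ∀ a : Fin (N + 1) → ℂ,
      ‖∑ j, a j • u j‖ ^ 2 - C * ‖Th (∑ j, a j • u j)‖ ^ 2 ≤ -δ * ‖a‖ ^ 2 := fun a => by
    rw [stub_zeroLevelNullVector_form_span Th C huon hk4' a]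
    have h1 : ∑ j, (1 - C * κ (idx j)) * ‖a j‖ ^ 2 ≤ ∑ j, (-δ) * ‖a j‖ ^ 2 :=
      Finset.sum_le_sum fun j _ =>
        mul_le_mul_of_nonneg_right (by linarith [hδle (idx j) (hidxI j)]) (sq_nonneg _)
    refine h1.trans ?_
    rw [← Finset.mul_sum]
    have := stub_zeroLevelNullVector_pi_norm_sq_le a
    nlinarith
  -- the approximation scale
  set G : ℝ := 1 + |C| * ‖Th‖ ^ 2 with hG
  have hG1 : 1 ≤ G := by rw [hG]; nlinarith [abs_nonneg C, sq_nonneg ‖Th‖]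
  set P : ℝ := ((N : ℝ) + 1) ^ 2 with hP
  have hP0 : 0 < P := by positivity
  set η : ℝ := min 1 (δ / (6 * G * P)) with hη
  have hηpos : 0 < η := lt_min one_pos (by positivity)
  have hη1 : η ≤ 1 := min_le_left _ _
  have hηδ : 3 * η * G * P ≤ δ / 2 := by
    have h1 : η ≤ δ / (6 * G * P) := min_le_right _ _
    have h2 : η * (6 * G * P) ≤ δ := by
      rwa [le_div_iff₀ (by positivity)] at h1
    linarith
  -- core approximants of the eigenvectors
  have hdense : DenseRange ((↑) : W → UniformSpace.Completion W) :=
    UniformSpace.Completion.denseRange_coe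
  have hy_ex : ∀ j, ∃ y : W, dist (u j) (y : UniformSpace.Completion W) < η := fun j =>
    hdense.exists_dist_lt (u j) hηpos
  choose y hy using hy_ex
  have hy' : ∀ j, ‖(y j : UniformSpace.Completion W) - u j‖ ≤ η := fun j => by
    rw [← dist_eq_norm, dist_comm]; exact (hy j).le
  have hcoe_sum : ∀ a : Fin (N + 1) → ℂ,
      ((∑ j, a j • y j : W) : UniformSpace.Completion W) =
        ∑ j, a j • (y j : UniformSpace.Completion W) := fun a => by
    have h := map_sum (UniformSpace.Completion.toComplₗᵢ : W →ₗᵢ[ℂ] UniformSpace.Completion W)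
      (fun j => a j • y j) Finset.univ
    simp only [LinearIsometry.map_smul] at h
    exact h
  -- the key estimate on the core span
  have hkey : ∀ a : Fin (N + 1) → ℂ,
      ‖∑ j, a j • y j‖ ^ 2 - C * ‖T (∑ j, a j • y j)‖ ^ 2 ≤ -(δ / 2) * ‖a‖ ^ 2 ∧
      ‖T (∑ j, a j • y j)‖ ≤ ‖Th‖ * (2 * (((N : ℝ) + 1) * ‖a‖)) := fun a => by
    set M : ℝ := ((N : ℝ) + 1) * ‖a‖ with hM
    have hM0 : 0 ≤ M := by positivity
    have hz_le : ‖∑ j, a j • u j‖ ≤ M := by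
      have h := stub_zeroLevelNullVector_norm_sum_smul_le a u (fun j => (huon.1 j).le)
      rw [mul_one] at h
      exact h
    have hdiff : ‖((∑ j, a j • y j : W) : UniformSpace.Completion W) - ∑ j, a j • u j‖ ≤ η * M := by
      have h : ((∑ j, a j • y j : W) : UniformSpace.Completion W) - ∑ j, a j • u j =
          ∑ j, a j • ((y j : UniformSpace.Completion W) - u j) := by
        rw [hcoe_sum, ← Finset.sum_sub_distrib]
        refine Finset.sum_congr rfl fun j _ => ?_
        rw [smul_sub]
      rw [h]
      have h2 := stub_zeroLevelNullVector_norm_sum_smul_le a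
        (fun j => (y j : UniformSpace.Completion W) - u j) hy'
      rw [hM]
      linarith
    have hpert := stub_zeroLevelNullVector_form_perturb Th C hM0 hηpos.le hη1 hz_le hdiff
    have hMP : M ^ 2 = P * ‖a‖ ^ 2 := by rw [hM, hP]; ring
    refine ⟨?_, ?_⟩
    · rw [← UniformSpace.Completion.norm_coe (∑ j, a j • y j), ← hTh]
      refine hpert.trans ?_
      have h1 := hqz a
      have h3 : 3 * η * (1 + |C| * ‖Th‖ ^ 2) * M ^ 2 ≤ (δ / 2) * ‖a‖ ^ 2 := by
        rw [hMP, ← hG]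
        have := mul_le_mul_of_nonneg_right hηδ (sq_nonneg ‖a‖)
        calc 3 * η * G * (P * ‖a‖ ^ 2) = 3 * η * G * P * ‖a‖ ^ 2 := by ring
          _ ≤ δ / 2 * ‖a‖ ^ 2 := this
      linarith
    · rw [← hTh]
      refine (Th.le_opNorm _).trans (mul_le_mul_of_nonneg_left ?_ (norm_nonneg _))
      have h1 := norm_sub_norm_le ((∑ j, a j • y j : W) : UniformSpace.Completion W)
        (∑ j, a j • u j)
      have hηM : η * M ≤ M := by nlinarith
      linarith
  -- linear independence of the approximants
  have hyli : LinearIndependent ℂ y := by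
    refine Fintype.linearIndependent_iff.2 fun a ha => ?_
    have h := (hkey a).1
    rw [ha, map_zero, norm_zero, norm_zero, zero_pow two_ne_zero, mul_zero, sub_zero] at h
    have ha0 : ‖a‖ ^ 2 ≤ 0 := by
      by_contra hcon
      push Not at hcon
      have : -(δ / 2) * ‖a‖ ^ 2 < 0 := mul_neg_of_neg_of_pos (by linarith) hcon
      linarith
    have ha0' : ‖a‖ = 0 := by nlinarith [norm_nonneg a]
    rw [norm_eq_zero] at ha0'
    exact fun j => by rw [ha0']; rfl
  -- the inner level set lies below `-(δ/2) / t²`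
  obtain ⟨hne, -, -⟩ := stub_zeroLevelNullVector_inner_nonempty_bddAbove T C hTinj hyli
  set t : ℝ := ‖Th‖ * (2 * ((N : ℝ) + 1)) with ht
  have hct : ∀ c : Fin (N + 1) → ℂ, ‖T (∑ i, c i • y i)‖ ^ 2 = 1 → 1 ≤ t * ‖c‖ := fun c hc => by
    have h1 : ‖T (∑ i, c i • y i)‖ = 1 := by
      rwa [pow_eq_one_iff_of_nonneg (norm_nonneg _) two_ne_zero] at hc
    have h2 := (hkey c).2
    rw [h1] at h2
    rw [ht]
    linarith
  have htpos : 0 < t := by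
    obtain ⟨_, c₀, hc₀, -⟩ := hne
    have h := hct c₀ hc₀
    by_contra hle
    push Not at hle
    have : t * ‖c₀‖ ≤ 0 := mul_nonpos_of_nonpos_of_nonneg hle (norm_nonneg _)
    linarith
  have hbound : sSup {r : ℝ | ∃ c : Fin (N + 1) → ℂ, ‖T (∑ i, c i • y i)‖ ^ 2 = 1 ∧
      r = ‖∑ i, c i • y i‖ ^ 2 - C * ‖T (∑ i, c i • y i)‖ ^ 2} ≤ -(δ / 2) / t ^ 2 := by
    refine csSup_le hne ?_
    rintro r ⟨c, hc1, rfl⟩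
    have h1 := hct c hc1
    have h2 : 1 / t ^ 2 ≤ ‖c‖ ^ 2 := by
      rw [div_le_iff₀ (by positivity)]
      have h0 : 0 ≤ t * ‖c‖ := by positivity
      calc (1 : ℝ) = 1 ^ 2 := (one_pow 2).symm
        _ ≤ (t * ‖c‖) ^ 2 := pow_le_pow_left₀ zero_le_one h1 2
        _ = ‖c‖ ^ 2 * t ^ 2 := by ring
    have h3 := (hkey c).1
    have h4 : -(δ / 2) * ‖c‖ ^ 2 ≤ -(δ / 2) / t ^ 2 := by
      rw [show -(δ / 2) / t ^ 2 = -(δ / 2) * (1 / t ^ 2) by ring]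
      exact mul_le_mul_of_nonpos_left h2 (by linarith)
    linarith
  exact ⟨y, hyli, lt_of_le_of_lt hbound (div_neg_of_neg_of_pos (by linarith) (by positivity))⟩


end ClaimUpper

/-! ### Extraction of the witnesses and the abstract attainment theorem -/

section Main

omit [CompleteSpace H] in
/-- **A null vector of the closed form yields the witnesses**: if `e` in the completion satisfies
`⟪z, e⟫ = C ⟪T̂ z, T̂ e⟫` for all `z` and `T̂ e ≠ 0`, then core approximants `xₙ → e` give
`T xₙ → T̂ e ≠ 0`, form-Cauchy differences, and `⟪h, xₙ⟫ - C ⟪T h, T xₙ⟫ → 0` for every core `h`. [folklore] -/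
theorem stub_zeroLevelNullVector_extract (T : W →L[ℂ] H) (C : ℝ)
    (Th : UniformSpace.Completion W →L[ℂ] H) (hTh : ∀ x : W, Th x = T x)
    {e : UniformSpace.Completion W}
    (hnull : ∀ z : UniformSpace.Completion W, ⟪z, e⟫_ℂ - C * ⟪Th z, Th e⟫_ℂ = 0)
    (hTe : Th e ≠ 0) :
    ∃ (v : H) (x : ℕ → W), v ≠ 0 ∧ Tendsto (fun n => T (x n)) atTop (𝓝 v) ∧
      Tendsto (fun q : ℕ × ℕ => ‖x q.1 - x q.2‖ ^ 2 - C * ‖T (x q.1 - x q.2)‖ ^ 2) atTop (𝓝 0) ∧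
      ∀ h : W, Tendsto (fun n => ⟪h, x n⟫_ℂ - C * ⟪T h, T (x n)⟫_ℂ) atTop (𝓝 0) := by
  have hdense : DenseRange ((↑) : W → UniformSpace.Completion W) :=
    UniformSpace.Completion.denseRange_coe
  have hx_ex : ∀ n : ℕ, ∃ x : W, dist e (x : UniformSpace.Completion W) < 1 / ((n : ℝ) + 1) :=
    fun n => hdense.exists_dist_lt e (by positivity)
  choose x hx using hx_ex
  have hxe : Tendsto (fun n => (x n : UniformSpace.Completion W)) atTop (𝓝 e) := by
    rw [tendsto_iff_dist_tendsto_zero]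
    refine squeeze_zero (fun n => dist_nonneg) (fun n => ?_) tendsto_one_div_add_atTop_nhds_zero_nat
    rw [dist_comm]
    exact (hx n).le
  refine ⟨Th e, x, hTe, ?_, ?_, fun h => ?_⟩
  · have h1 := (Th.continuous.tendsto e).comp hxe
    refine (tendsto_congr fun n => ?_).1 h1
    exact hTh (x n)
  · have hF : Continuous fun p : UniformSpace.Completion W × UniformSpace.Completion W =>
        ‖p.1 - p.2‖ ^ 2 - C * ‖Th (p.1 - p.2)‖ ^ 2 := by fun_prop
    have hpair : Tendsto (fun q : ℕ × ℕ =>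
        ((x q.1 : UniformSpace.Completion W), (x q.2 : UniformSpace.Completion W))) atTop
        (𝓝 (e, e)) := by
      rw [← Filter.prod_atTop_atTop_eq, nhds_prod_eq]
      exact hxe.prodMap hxe
    have h1 := (hF.tendsto (e, e)).comp hpair
    simp only [sub_self, norm_zero, map_zero] at h1
    norm_num at h1
    refine (tendsto_congr fun q => ?_).1 h1
    simp only [Function.comp_apply]
    rw [← UniformSpace.Completion.coe_sub, UniformSpace.Completion.norm_coe, hTh, hTh, ← map_sub]
  · have hG : Continuous fun z : UniformSpace.Completion W =>
        ⟪(h : UniformSpace.Completion W), z⟫_ℂ - C * ⟪Th h, Th z⟫_ℂ := by fun_prop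
    have h1 := (hG.tendsto e).comp hxe
    simp only [hnull] at h1
    refine (tendsto_congr fun n => ?_).1 h1
    simp only [Function.comp_apply]
    rw [UniformSpace.Completion.inner_coe, hTh, hTh]


end Main

end AbstractLayer

/-! ### `N + 1` linearly independent test functions on a window -/

section Bumps

/-- **The core of the window is infinite-dimensional**: for `a > 0` and every `N` there are `N + 1`
linearly independent test functions supported in `[-a, a]` (smooth bumps with pairwise disjoint
supports, independent by evaluation at their centres). [folklore] -/
theorem stub_zeroLevelNullVector_exists_linearIndependent :
    ∀ (N : ℕ) {a : ℝ}, 0 < a →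
      ∃ g : Fin (N + 1) → ℝ → ℂ, (∀ i, IsWeilTest (g i) ∧ tsupport (g i) ⊆ Set.Icc (-a) a) ∧
        LinearIndependent ℂ g := by
  intro N a ha
  classical
  set hs : ℝ := a / ((N : ℝ) + 1) with hhs
  have hspos : 0 < hs := by positivity
  have hNhs : ((N : ℝ) + 1) * hs = a := by
    rw [hhs]; field_simp
  set ctr : Fin (N + 1) → ℝ := fun j => -a + (2 * (j : ℝ) + 1) * hs with hctr
  have hb : ∀ j, ∃ b : ContDiffBump (ctr j), b.rIn = hs / 4 ∧ b.rOut = hs / 2 := fun j =>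
    ⟨⟨hs / 4, hs / 2, by positivity, by linarith⟩, rfl, rfl⟩
  choose b hbIn hbOut using hb
  set g : Fin (N + 1) → ℝ → ℂ := fun j t => ((b j t : ℝ) : ℂ) with hg
  have hjN : ∀ j : Fin (N + 1), (j : ℝ) ≤ N := fun j => by
    exact_mod_cast Nat.le_of_lt_succ j.isLt
  refine ⟨g, fun j => ⟨⟨Complex.ofRealCLM.contDiff.comp (b j).contDiff,
    (b j).hasCompactSupport.comp_left Complex.ofReal_zero⟩, ?_⟩, ?_⟩
  · refine (tsupport_comp_subset Complex.ofReal_zero _).trans ?_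
    rw [(b j).tsupport_eq, hbOut, Real.closedBall_eq_Icc]
    have h0 : (0 : ℝ) ≤ (j : ℝ) := Nat.cast_nonneg _
    refine Set.Icc_subset_Icc ?_ ?_
    · rw [hctr]
      nlinarith
    · rw [hctr]
      have := hjN j
      nlinarith
  · refine Fintype.linearIndependent_iff.2 fun c hc j => ?_
    have h := congr_fun hc (ctr j)
    rw [Finset.sum_apply] at h
    simp only [Pi.smul_apply, smul_eq_mul, Pi.zero_apply] at h
    have hval : ∀ i, g i (ctr j) = if i = j then 1 else 0 := fun i => by
      by_cases hij : i = j
      · subst hij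
        rw [if_pos rfl, hg]
        simp only
        rw [(b i).one_of_mem_closedBall (Metric.mem_closedBall_self (by rw [hbIn]; positivity)),
          Complex.ofReal_one]
      · rw [if_neg hij, hg]
        simp only
        rw [(b i).zero_of_le_dist ?_, Complex.ofReal_zero]
        rw [hbOut, Real.dist_eq, hctr]
        simp only
        have hne : (i : ℕ) ≠ (j : ℕ) := fun h' => hij (Fin.ext h')
        have h1 : (1 : ℝ) ≤ |(j : ℝ) - (i : ℝ)| := by
          rcases lt_or_gt_of_ne hne with hlt | hlt
          · have : (i : ℝ) + 1 ≤ (j : ℝ) := by exact_mod_cast hlt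
            rw [abs_of_nonneg (by linarith)]; linarith
          · have : (j : ℝ) + 1 ≤ (i : ℝ) := by exact_mod_cast hlt
            rw [abs_of_nonpos (by linarith)]; linarith
        have e : -a + (2 * (j : ℝ) + 1) * hs - (-a + (2 * (i : ℝ) + 1) * hs) =
            2 * hs * ((j : ℝ) - (i : ℝ)) := by ring
        rw [e, abs_mul, abs_of_pos (by positivity : (0 : ℝ) < 2 * hs)]
        nlinarith
    simp_rw [hval] at h
    simpa using h

end Bumps

end Summit.RiemannHypothesis.RiemannHypothesis.Theorems.RuelleBandCofiniteCriticalLine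

end
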